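import Literature.Analysis.FluidPDE.VorticityCalculus
import Literature.Analysis.FluidPDE.VectorCalculusProofs

/-!
# Apex foam, part 2: the witness field (negative-side support for `stub_slabApexBound`, line `Sketch` of the
  crux `SlicedKelvin.PlanarFluxAPriori`, stmt-NavierStokesRegularity-15600)

Refuter cdisprove seat g2, cycle 1 (2026-08-17); see part 1 (`…ApexFoamProfile.lean`) for the context and
`Negative/SlabApexBoundFalseKinematic.lean` for the conclusions. For a profile `g : ℝ → ℝ` the WITNESS is
`v = curl (χ Ψ₀)`, `Ψ₀ = (−x₀x₂g(x₁), 0, x₁x₂)`, `χ` a smooth bump equal to `1` on `B(0,2)` and supported in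
`B(0,3)`. It is `C^∞_c` (`contDiff_vfield`, `hasCompactSupport_vfield`), divergence free (`isDivFree_vfield`: the
tree's `div curl = 0`), rapidly decaying (`hasRapidSpatialDecay_vfield`) — an admissible Clay datum — and satisfies
the cubic-decay hypothesis of the kinematic stubs (`cubicDecay_vfield`). On the core `B(0,2)`:
`v = V₀ = (x₂, −x₀g(x₁), x₀x₂g'(x₁))` (`curl_Ψ₀`, `vfield_eq`), `curl v = W₀ = (x₀x₂g''(x₁), 1 − x₂g'(x₁), −g(x₁))`
(`curl_V₀`, `curl_vfield_eq`); hence the normal vorticity is `f = ⟪curl v, e₂⟫ = −g(x₁)` (`normalVorticity_eq`)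
and the apex density is `Df[curl v] = −g'(x₁)(1 − x₂g'(x₁))` (`fderiv_normalVorticity_apply`): the vortex lines
run along `e₁` and fold wherever `g` vanishes. Also recorded: the stub's integrand `G` for the witness in the
frame `R = 1`, its product minorant `Θ` on the box `Kset h'`, and the coordinate swap `Rsw` used for Fubini.

Mathlib + the tree's curl calculus (`curl_eq_curlCLM`, `contDiff_curl`, `hasCompactSupport_curl`,
`divergence_curl_eq_zero_holds`); no Navier–Stokes dynamics enters.
-/

noncomputable section

-- Problem = summit for this single-conjunct summit: the duplicate namespace component is deliberate.
set_option linter.dupNamespace false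

namespace Summit.NavierStokesRegularity.NavierStokesRegularity.Theorems.PlanarFluxAPriori.Negative.ApexFoam

open MeasureTheory Set Function Filter Topology Literature.Analysis.FluidPDE
open scoped ENNReal InnerProductSpace RealInnerProductSpace ContDiff

/-! ### The witness field on `ℝ³` -/

local notation "E3" => EuclideanSpace ℝ (Fin 3)
local notation "E2" => EuclideanSpace ℝ (Fin 2)

/-- standard basis vectors -/
def e (i : Fin 3) : E3 := EuclideanSpace.single i 1

/-- coordinate projections -/
def P (i : Fin 3) : E3 →L[ℝ] ℝ := EuclideanSpace.proj i

/-- `P i x = xᵢ`. -/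
theorem P_apply (i : Fin 3) (x : E3) : P i x = x i := rfl

/-- the cut-off: `1` on the ball of radius `2`, supported in the ball of radius `3` -/
def χ : ContDiffBump (0 : E3) := ⟨2, 3, two_pos, by norm_num⟩

section Field
variable (g : ℝ → ℝ)

/-- vector potential, core form `Ψ₀ = (−x₀x₂ g(x₁), 0, x₁x₂)` -/
def Ψ₀ (x : E3) : E3 := (-(x 0 * x 2 * g (x 1))) • e 0 + (x 1 * x 2) • e 2
/-- its curl, the core velocity `V₀ = (x₂, −x₀ g(x₁), x₀x₂ g'(x₁))` -/
def V₀ (x : E3) : E3 := (x 2) • e 0 + (-(x 0 * g (x 1))) • e 1 + (x 0 * x 2 * deriv g (x 1)) • e 2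
/-- its curl, the core vorticity `W₀ = (x₀x₂ g''(x₁), 1 − x₂ g'(x₁), −g(x₁))` -/
def W₀ (x : E3) : E3 :=
  (x 0 * x 2 * deriv (deriv g) (x 1)) • e 0 + (1 - x 2 * deriv g (x 1)) • e 1 + (-(g (x 1))) • e 2
/-- the localised potential -/
def Ψ (x : E3) : E3 := χ x • Ψ₀ g x
/-- **the witness**: `v = curl (χ Ψ₀)` — smooth, compactly supported, divergence free -/
def vfield : E3 → E3 := curl (Ψ g)

/-- `(W₀)₁ = 1 − x₂ g'(x₁)`: the component crossing the fold sheets `{x₁ = const}`. -/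
@[simp] theorem W₀_apply_one (x : E3) : W₀ g x 1 = 1 - x 2 * deriv g (x 1) := by simp [W₀, e]
/-- `(W₀)₂ = −g(x₁)`: the normal vorticity is the profile. -/
@[simp] theorem W₀_apply_two (x : E3) : W₀ g x 2 = -(g (x 1)) := by simp [W₀, e]

variable {g}
variable (hg : ContDiff ℝ ∞ g)
include hg

/-- `x ↦ g(x₁)` is smooth. -/
theorem contDiff_gcomp : ContDiff ℝ ∞ fun x : E3 => g (x 1) := hg.comp (P 1).contDiff
/-- `g'` is smooth. -/
theorem contDiff_dg : ContDiff ℝ ∞ (deriv g) := (contDiff_infty_iff_deriv.1 hg).2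
/-- `x ↦ g'(x₁)` is smooth. -/
theorem contDiff_dgcomp : ContDiff ℝ ∞ fun x : E3 => deriv g (x 1) := (contDiff_dg hg).comp (P 1).contDiff

/-- `Ψ₀` is smooth. -/
theorem contDiff_Ψ₀ : ContDiff ℝ ∞ (Ψ₀ g) := by
  unfold Ψ₀
  exact ((((P 0).contDiff.mul (P 2).contDiff).mul (contDiff_gcomp hg)).neg.smul contDiff_const).add
    (((P 1).contDiff.mul (P 2).contDiff).smul contDiff_const)

/-- `V₀` is smooth. -/
theorem contDiff_V₀ : ContDiff ℝ ∞ (V₀ g) := by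
  unfold V₀
  exact (((P 2).contDiff.smul contDiff_const).add
    (((P 0).contDiff.mul (contDiff_gcomp hg)).neg.smul contDiff_const)).add
    ((((P 0).contDiff.mul (P 2).contDiff).mul (contDiff_dgcomp hg)).smul contDiff_const)

/-- `Ψ = χ Ψ₀` is smooth. -/
theorem contDiff_Ψ : ContDiff ℝ ∞ (Ψ g) := χ.contDiff.smul (contDiff_Ψ₀ hg)

/-- **The witness is smooth** (`curl` of a smooth field). -/
theorem contDiff_vfield : ContDiff ℝ ∞ (vfield g) :=
  contDiff_curl (n := (⊤ : ℕ∞)) (by exact_mod_cast contDiff_Ψ hg)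

omit hg in
/-- `Ψ` is compactly supported. -/
theorem hasCompactSupport_Ψ : HasCompactSupport (Ψ g) := χ.hasCompactSupport.smul_right

omit hg in
/-- **The witness is compactly supported.** -/
theorem hasCompactSupport_vfield : HasCompactSupport (vfield g) := hasCompactSupport_curl hasCompactSupport_Ψ

/-- **The witness is divergence free** (`div curl = 0`, tree `divergence_curl_eq_zero_holds`). -/
theorem isDivFree_vfield : VectorCalculus.IsDivFree (vfield g) := fun x =>
  divergence_curl_eq_zero_holds (Ψ g) ((contDiff_Ψ hg).of_le (by norm_cast)) x

omit hg in
/-- Smooth compactly supported fields decay rapidly (Fefferman (4)). -/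
theorem hasRapidSpatialDecay_of_hasCompactSupport {f : E3 → E3} (hf : ContDiff ℝ ∞ f)
    (hc : HasCompactSupport f) : HasRapidSpatialDecay f := by
  intro n K
  have hcont : Continuous fun x => (1 + ‖x‖) ^ K * ‖iteratedFDeriv ℝ n f x‖ :=
    ((continuous_const.add continuous_norm).pow K).mul
      (hf.continuous_iteratedFDeriv (m := n) (by exact_mod_cast le_top)).norm
  have hsupp : HasCompactSupport fun x => (1 + ‖x‖) ^ K * ‖iteratedFDeriv ℝ n f x‖ :=
    ((hc.iteratedFDeriv (𝕜 := ℝ) n).norm).mul_left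
  obtain ⟨C, hC⟩ := hcont.bddAbove_range_of_hasCompactSupport hsupp
  exact ⟨C, fun x => hC ⟨x, rfl⟩⟩

/-- **The witness decays rapidly** (it is an admissible Clay datum). -/
theorem hasRapidSpatialDecay_vfield : HasRapidSpatialDecay (vfield g) :=
  hasRapidSpatialDecay_of_hasCompactSupport (contDiff_vfield hg) hasCompactSupport_vfield

/-- The witness satisfies the cubic-decay hypothesis of the kinematic stubs of line `Sketch` (`k ≤ 3`). -/
theorem cubicDecay_vfield : ∃ C : ℝ, ∀ (x : E3) (k : ℕ), k ≤ 3 →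
    (1 + ‖x‖) ^ 3 * ‖iteratedFDeriv ℝ k (vfield g) x‖ ≤ C := by
  have h := hasRapidSpatialDecay_vfield hg
  choose Cf hCf using fun k => h k 3
  refine ⟨max (max (Cf 0) (Cf 1)) (max (Cf 2) (Cf 3)), fun x k hk => ?_⟩
  interval_cases k
  · exact (hCf 0 x).trans (le_max_of_le_left (le_max_left _ _))
  · exact (hCf 1 x).trans (le_max_of_le_left (le_max_right _ _))
  · exact (hCf 2 x).trans (le_max_of_le_right (le_max_left _ _))
  · exact (hCf 3 x).trans (le_max_of_le_right (le_max_right _ _))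

/-! #### The two curls on the core -/

/-- `D[g(x₁)] = g'(x₁) P₁`. -/
theorem hasFDerivAt_gcomp (x : E3) : HasFDerivAt (fun y : E3 => g (y 1)) (deriv g (x 1) • P 1) x := by
  have hd : HasDerivAt g (deriv g (x 1)) (P 1 x) := (hg.differentiable (by simp) _).hasDerivAt
  exact hd.comp_hasFDerivAt x (P 1).hasFDerivAt

/-- `D[g'(x₁)] = g''(x₁) P₁`. -/
theorem hasFDerivAt_dgcomp (x : E3) :
    HasFDerivAt (fun y : E3 => deriv g (y 1)) (deriv (deriv g) (x 1) • P 1) x := by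
  have hd : HasDerivAt (deriv g) (deriv (deriv g) (x 1)) (P 1 x) :=
    ((contDiff_dg hg).differentiable (by simp) _).hasDerivAt
  exact hd.comp_hasFDerivAt x (P 1).hasFDerivAt

/-- **First curl**: `curl Ψ₀ = V₀ = (x₂, −x₀g(x₁), x₀x₂g'(x₁))`. -/
theorem curl_Ψ₀ (x : E3) : curl (Ψ₀ g) x = V₀ g x := by
  have h1 : HasFDerivAt (fun y : E3 => y 0 * y 2 * g (y 1))
      ((x 0 * x 2) • (deriv g (x 1) • P 1) + g (x 1) • (x 0 • P 2 + x 2 • P 0)) x :=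
    ((P 0).hasFDerivAt.mul (P 2).hasFDerivAt).mul (hasFDerivAt_gcomp hg x)
  have h2 : HasFDerivAt (fun y : E3 => y 1 * y 2) (x 1 • P 2 + x 2 • P 1) x :=
    (P 1).hasFDerivAt.mul (P 2).hasFDerivAt
  have h : HasFDerivAt (Ψ₀ g) ((-((x 0 * x 2) • (deriv g (x 1) • P 1) + g (x 1) • (x 0 • P 2 + x 2 • P 0))).smulRight (e 0) + (x 1 • P 2 + x 2 • P 1).smulRight (e 2)) x :=
    (h1.neg.smul_const (e 0)).add (h2.smul_const (e 2))
  ext i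
  fin_cases i
  · simp [curl, h.fderiv, V₀, e, P_apply]
  · simp [curl, h.fderiv, V₀, e, P_apply]; ring
  · simp [curl, h.fderiv, V₀, e, P_apply]


/-- **Second curl**: `curl V₀ = W₀ = (x₀x₂g''(x₁), 1 − x₂g'(x₁), −g(x₁))`. -/
theorem curl_V₀ (x : E3) : curl (V₀ g) x = W₀ g x := by
  have h1 : HasFDerivAt (fun y : E3 => y 0 * g (y 1)) (x 0 • (deriv g (x 1) • P 1) + g (x 1) • P 0) x :=
    (P 0).hasFDerivAt.mul (hasFDerivAt_gcomp hg x)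
  have h2 : HasFDerivAt (fun y : E3 => y 0 * y 2 * deriv g (y 1))
      ((x 0 * x 2) • (deriv (deriv g) (x 1) • P 1) + deriv g (x 1) • (x 0 • P 2 + x 2 • P 0)) x :=
    ((P 0).hasFDerivAt.mul (P 2).hasFDerivAt).mul (hasFDerivAt_dgcomp hg x)
  have h : HasFDerivAt (V₀ g) ((P 2).smulRight (e 0) +
      (-(x 0 • (deriv g (x 1) • P 1) + g (x 1) • P 0)).smulRight (e 1) +
      ((x 0 * x 2) • (deriv (deriv g) (x 1) • P 1) + deriv g (x 1) • (x 0 • P 2 + x 2 • P 0)).smulRight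
        (e 2)) x :=
    (((P 2).hasFDerivAt.smul_const (e 0)).add (h1.neg.smul_const (e 1))).add (h2.smul_const (e 2))
  ext i
  fin_cases i
  · simp [curl, h.fderiv, W₀, e, P_apply]
  · simp [curl, h.fderiv, W₀, e, P_apply]; ring
  · simp [curl, h.fderiv, W₀, e, P_apply]

/-! #### The field on the core ball `B(0, 2)` -/

omit hg in
/-- On the core ball `B(0,2)` the cut-off is `1`: `Ψ = Ψ₀`. -/
theorem Ψ_eqOn : EqOn (Ψ g) (Ψ₀ g) (Metric.ball (0 : E3) 2) := fun x hx => by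
  have h1 : χ x = 1 := χ.one_of_mem_closedBall (Metric.ball_subset_closedBall hx)
  simp [Ψ, h1]

omit hg in
/-- `Ψ = Ψ₀` near every point of the core. -/
theorem Ψ_eventuallyEq {x : E3} (hx : x ∈ Metric.ball (0 : E3) 2) : Ψ g =ᶠ[𝓝 x] Ψ₀ g :=
  (Metric.isOpen_ball.eventually_mem hx).mono fun _ hy => Ψ_eqOn hy

/-- On the core `v = V₀`. -/
theorem vfield_eq {x : E3} (hx : x ∈ Metric.ball (0 : E3) 2) : vfield g x = V₀ g x := by
  rw [vfield, curl_eq_curlCLM, (Ψ_eventuallyEq hx).fderiv_eq, ← curl_eq_curlCLM, curl_Ψ₀ hg]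

/-- `v = V₀` near every point of the core. -/
theorem vfield_eventuallyEq {x : E3} (hx : x ∈ Metric.ball (0 : E3) 2) : vfield g =ᶠ[𝓝 x] V₀ g :=
  (Metric.isOpen_ball.eventually_mem hx).mono fun _ hy => vfield_eq hg hy

/-- On the core `curl v = W₀`. -/
theorem curl_vfield_eq {x : E3} (hx : x ∈ Metric.ball (0 : E3) 2) : curl (vfield g) x = W₀ g x := by
  rw [curl_eq_curlCLM, (vfield_eventuallyEq hg hx).fderiv_eq, ← curl_eq_curlCLM, curl_V₀ hg]

/-- On the core the normal vorticity is the fold profile: `⟪curl v, e₂⟫ = −g(x₁)`. -/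
theorem normalVorticity_eq {x : E3} (hx : x ∈ Metric.ball (0 : E3) 2) :
    ⟪curl (vfield g) x, e 2⟫ = -(g (x 1)) := by
  rw [curl_vfield_eq hg hx, e, EuclideanSpace.inner_single_right]
  simp

/-- `⟪curl v, e₂⟫ = −g(x₁)` near every point of the core. -/
theorem normalVorticity_eventuallyEq {x : E3} (hx : x ∈ Metric.ball (0 : E3) 2) :
    (fun z => ⟪curl (vfield g) z, e 2⟫) =ᶠ[𝓝 x] fun z => -(g (z 1)) :=
  (Metric.isOpen_ball.eventually_mem hx).mono fun _ hy => normalVorticity_eq hg hy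

/-- On the core the apex density `Df[ω]` is `−g'(x₁)(1 − x₂ g'(x₁))`. -/
theorem fderiv_normalVorticity_apply {x : E3} (hx : x ∈ Metric.ball (0 : E3) 2) :
    fderiv ℝ (fun z => ⟪curl (vfield g) z, e 2⟫) x (curl (vfield g) x) =
      -(deriv g (x 1) * (1 - x 2 * deriv g (x 1))) := by
  have hneg : HasFDerivAt (fun z : E3 => -(g (z 1))) (-(deriv g (x 1) • P 1)) x :=
    (hasFDerivAt_gcomp hg x).neg
  rw [(normalVorticity_eventuallyEq hg hx).fderiv_eq, hneg.fderiv, curl_vfield_eq hg hx]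
  simp [P_apply]


end Field

/-! ### The stub's integrand for the witness and its product minorant (used in `…FalseKinematic`) -/

section Slab
variable (g : ℝ → ℝ)

/-- The integrand of `stub_slabApexBound` (frame `R = 1`) for the witness field:
`ofReal (ε²/√(f²+ε²)³ · |Df[curl v]|)`, `f = ⟪curl v, e₂⟫`. -/
def G (ε : ℝ) (x : E3) : ℝ≥0∞ :=
  ENNReal.ofReal (ε ^ 2 / Real.sqrt (⟪curl (vfield g) x, e 2⟫ ^ 2 + ε ^ 2) ^ 3 *
    |fderiv ℝ (fun z => ⟪curl (vfield g) z, e 2⟫) x (curl (vfield g) x)|)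

/-- The box carrying the folds: `x₁ ∈ [0,1]`, `x₀² + x₂² < h'²`. -/
def Kset (h' : ℝ) : Set E3 := {x | x 1 ∈ Icc (0 : ℝ) 1 ∧ x 0 ^ 2 + x 2 ^ 2 < h' ^ 2}

/-- The product minorant of `G` on the box: half the apex density `ε²/√(g²+ε²)³·|g'|` of the profile at `x₁`
(= `ApexFoam.apexDensity ε g (x 1) / 2` of part 1). -/
def Θ (ε h' : ℝ) : E3 → ℝ≥0∞ :=
  (Kset h').indicator fun x =>
    ENNReal.ofReal (ε ^ 2 / Real.sqrt (g (x 1) ^ 2 + ε ^ 2) ^ 3 * |deriv g (x 1)| / 2)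

/-- The Fubini frame: the linear isometry swapping the coordinates `1` and `2`. -/
def Rsw : E3 ≃ₗᵢ[ℝ] E3 := LinearIsometryEquiv.piLpCongrLeft 2 ℝ ℝ (Equiv.swap (1 : Fin 3) 2)

/-- `Rsw (a, b, c) = (a, c, b)`. -/
theorem Rsw_apply (a b c : ℝ) : Rsw (WithLp.toLp 2 ![a, b, c]) = WithLp.toLp 2 ![a, c, b] := by
  ext i
  fin_cases i <;> simp [Rsw, LinearIsometryEquiv.piLpCongrLeft_apply, Equiv.swap_apply_def]

end Slab

end Summit.NavierStokesRegularity.NavierStokesRegularity.Theorems.PlanarFluxAPriori.Negative.ApexFoam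

end
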